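import Literature.Geometry.Lorentzian.BondiBartnikGap
import Literature.Geometry.Lorentzian.SoundNearKerrLeaf
import HarnessLib

/-!
# The probe sector (`N = 0`) of line `direct-method-on-the-cone` — crux `BondiBartnikRigidity`
# (stmt-FinalStateConjecture-10807), stub `stub_probeSector`: the two route-posited inputs

Typed statements (route-posited, `[conjecture]`; nothing is asserted) of the two facts to which the
registered FOREIGN stub `stub_probeSector` of
`Cruxes/BondiBartnikRigidity/Lines/direct_method_on_the_cone.lean` (skeleton rev 6) reduces, and the
bookkeeping half of that reduction which only involves the first of them:

* `ProbeRoute.ProbeBartnikMassZero` (B1) — the Bondi–Bartnik infimum of a point is `0`: a point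
  `p ∈ J⁺(ι X)` of an MGHD of admissible data has competitors (`VacuumCauchyDevelopment.IsCompetitorMass`)
  of arbitrarily small cut energy;
* `ProbeRoute.ConeEnergyPinchesFlatSound` (F4) — small cone energy pinches flat, SOUND form: a
  `(Λ, k')`-near-flat typed leaf `S ∋ p` without holes (`k'` chosen after `(k, ε)`, `Λ < 1`) whose cone
  cut at `p` has a Bondi energy `≤ γ` is followed INSIDE `J⁺({p})` by a SOUND `(ε, k)`-flat leaf
  (`CauchyDevelopment.IsSoundNearKerrLeaf`, so not satisfiable by dodging / time-stretched sheets);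
* `ProbeRoute.exists_hasCutBondiMass_le_of_gap` (proved): cheap competitors + gap `≤ γ` ⇒ an own cut
  energy `≤ γ + η` for every `η > 0` (`bondiBartnikGapLE_iff`), and the registered brick
  `stub_probeBartnikMassZeroGap` (B1 ⇒ that conclusion for every point of `J⁺(ι X)`).

The sorry-free reduction `stub_probeSector_of_facts : ProbeBartnikMassZero → ConeEnergyPinchesFlatSound →
(registered signature of stub_probeSector)` and the Minkowski sanity instance of the conclusion are in the
companion file `…ProbeSectorReduction.lean`.

Audit of the sector (worker of lead c3, 2026-08-17; numbers in the report `Lines/…Probe…` of the crux):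
(1) NOT closable outright in Lean: for `N = 0` the hypothesis leaf hands Lean one flat chart `Ψ₀` with
`deviationCk (hypBackground U₀) Ψ₀ k' 0 ≤ Λ`, an UNWEIGHTED `sup_{m ≤ k'} sup_{t₀ = 0} ‖D^m(Ψ₀^* g − η)‖`
(`Spacetime.deviationCk`, `supCkENorm`): no decay weight, so no far region or re-charting of `S` improves
`Λ` to `ε < Λ` (re-chartings `Ψ₀ ∘ A` with `A(H) ⊆ H` are Lorentz, of operator norm `≥ 1`; a time-lift
`Ψ₀(· + τe₀)` leaves the certified sheet and the certified layer), and every other hypothesis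
(`HasCutBondiMass`, `BondiBartnikGapLE`, `IsMaximal`, `admissibleVacuumData`) is Lean-inert — cf. crux
note DODGE-c2 §3.  (2) B1 is Lean-inert both ways (a proof needs a constructed admissible MGHD carrying a
round receding section family with computed Hawking masses — none in the tree, not even for
`Minkowski.vacuumCauchyDevelopment`, whose maximality is itself only known modulo
`choquetBruhat_geroch_exists_mghd_cauchy`; a refutation needs the same); not junk-true (competitor masses
are honest Hawking-mass limits).  (3) F4 survives the symmetry checks (time orientation enters hypothesis
and conclusion alike; no scaling symmetry: the leaf predicates are unit-scale) and the short-pulse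
witnesses W3/W3″ of the report (a pulse of energy `μ ≤ γ` and width `≲ μ` must cross the `Λ`-certified
layer of `S` at distance `≥ μ^{1−k'}/Λ` from its focus, and `HasCutBondiMass {p} m` — smooth round
sections ON `∂J⁺{p}` — excludes strong lensing of the cone; with `k' ≥ 2k + 2` the two windows a
counterexample needs are disjoint); it is NOT in print (Chruściel–Paetz give positivity and the `ε = 0`
rigidity of the light-cone mass only).

References: Bartnik, ICM 2002, Def. 4 and §4 [Bartnik2002ICM]; Huang–Lee 2020, Def. 7.8 [HuangLee2020];
Czimek 2017 [Czimek2017]; Corvino 2000 [Corvino2000]; Corvino–Schoen 2006 [CorvinoSchoen2006];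
Christodoulou–Klainerman 1993, Thm. 1.0.2 and Ch. 17, Conclusion 17.0.4 [ChristodoulouKlainerman1993PMS41];
Klainerman–Nicolò 2003, Ch. 3 [KlainermanNicolo2003]; Chruściel–Paetz, arXiv:1401.3789, p. 4
[ChruscielPaetz2014]; Choquet-Bruhat–Chruściel–Martín-García, arXiv:0905.2133 [ChoquetBruhatChruscielMartinGarcia2009];
Christodoulou, arXiv:0805.3880 [Christodoulou2008].
-/

noncomputable section

-- D-0017: single-problem summit, `Summit.<S>.<S>.…` by design (cf. lakefile `weak.linter.dupNamespace`).
set_option linter.dupNamespace false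

open Set Filter Function Topology TopologicalSpace
open Literature.Geometry.Lorentzian
open scoped Manifold ContDiff Topology ENNReal

namespace Summit.FinalStateConjecture.FinalStateConjecture.Theorems.BondiBartnikRigidity.DirectMethod

namespace ProbeRoute

/-! ### The two route-posited facts of the probe sector -/

/-- **B1 — the Bondi–Bartnik infimum of a point is zero.**  On a maximal vacuum Cauchy development of
admissible data, a point `p ∈ J⁺(ι X)` has competitors (`VacuumCauchyDevelopment.IsCompetitorMass`:
an MGHD of admissible data receiving an isometric time-oriented open embedding of a neighbourhood of
`p`, with a Bondi energy `m'` of the cut generated by the image point) of arbitrarily small cut energy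
`m' ≤ η`.  Why needed: with the gap clause `BondiBartnikGapLE {p} γ` it is the only source of an
upper bound on the point's OWN cut energy (`exists_hasCutBondiMass_le_of_gap`; the identity competitor
is idle).  Paper route: induced data on a small spacelike ball through `p`, rescaled to unit size, are
close to trivial (the vacuum constraints are scale-invariant); extend to small asymptotically flat
vacuum data (ref: Czimek2017, Thm. 1.1) or glue a Schwarzschild end (ref: Corvino2000, Thm. 1)
(ref: CorvinoSchoen2006, Thm. 1); the small-data MGHD is a competitor on the domain of dependence of
the ball, and its cut energies are `≤ M_ADM → 0` with the ball's radius (ref: ChristodoulouKlainerman1993PMS41, Ch. 17, Conclusion 17.0.4);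
the competitor class is Bartnik's (ref: Bartnik2002ICM, Def. 4) in the route's Bondi form.  NOT in print
as stated (the transplant to `IsCompetitorMass`, incl. smooth round sections on the image cone); Lean-inert
in the tree (no admissible MGHD with a round receding family is constructed).
Route-posited statement; nothing is asserted. [conjecture] [folklore] -/
def ProbeBartnikMassZero : Prop :=
  ∀ (X : Type) [TopologicalSpace X] [ChartedSpace E3 X] [IsManifold (𝓡 3) ∞ X]
    [T2Space X] [SecondCountableTopology X] [ConnectedSpace X],
  ∀ D ∈ admissibleVacuumData X, ∀ (𝒟 : VacuumCauchyDevelopment D) (p : 𝒟.carrier),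
  𝒟.IsMaximal → p ∈ 𝒟.metric.causalFuture 𝒟.timeOrientation (range 𝒟.embed) →
  ∀ η : ℝ, 0 < η → ∃ m' : ℝ, 𝒟.IsCompetitorMass ({p} : Set 𝒟.carrier) m' ∧ m' ≤ η

/-- **F4 — small cone energy pinches flat, SOUND form.**  For every target `(k, ε)` there is a
regularity `k'` such that for every `Λ < 1` there is `γ > 0` with: in a maximal vacuum Cauchy development
of admissible data, a typed `(Λ, k')`-near-Kerr leaf `S ∋ p` WITHOUT holes whose cone cut at `p` has a
Bondi energy `m ≤ γ` is followed inside `J⁺({p})` by a SOUND `(ε, k)`-near-Kerr leaf without holes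
(`CauchyDevelopment.IsSoundNearKerrLeaf`: layer certification and an achronal sheet, so neither a
time-stretched nor a dodging sheet qualifies).  Why needed: it is the analytic content of the sector
once B1 has produced the small own cut energy; sound ⇒ typed and `J⁺{p} ⊆ J⁺(S)` then give the stub.
It is a large-data, semi-global stability-of-Minkowski statement near `𝓘⁺` inside `J⁺(p)` driven by
smallness of the Bondi energy of the cut of `C⁺(p)` and protected by the `C^{k'}` bound of the
hypothesis leaf (`k'` after `(k, ε)`: derivative loss).  In print only: small AF Cauchy data (ref: ChristodoulouKlainerman1993PMS41, Thm. 1.0.2),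
the exterior of large AF data (ref: KlainermanNicolo2003, Ch. 3), positivity of the light-cone mass with
the `ε = 0` endpoint "`m_TB = 0` on a globally smooth complete light cone ⇒ vacuum flat to its future"
(ref: ChruscielPaetz2014, p. 4) via (ref: ChoquetBruhatChruscielMartinGarcia2009, Thm. 1.1).  NOT in print:
anything quantitative reaching `J⁺(p)` of an interior point of a large-data MGHD.
Route-posited statement; nothing is asserted. [conjecture] [folklore] -/
def ConeEnergyPinchesFlatSound : Prop :=
  ∀ (k : ℕ) (ε : ℝ≥0∞), 0 < ε → ∃ k' : ℕ, ∀ Λ : ℝ≥0∞, Λ < 1 → ∃ γ : ℝ, 0 < γ ∧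
    ∀ (X : Type) [TopologicalSpace X] [ChartedSpace E3 X] [IsManifold (𝓡 3) ∞ X]
      [T2Space X] [SecondCountableTopology X] [ConnectedSpace X],
    ∀ D ∈ admissibleVacuumData X, ∀ (𝒟 : VacuumCauchyDevelopment D) (M a : Fin 0 → ℝ)
      (S : Set 𝒟.carrier) (p : 𝒟.carrier) (m : ℝ),
    𝒟.IsMaximal → 𝒟.toCauchyDevelopment.IsNearKerrLeaf k' Λ 0 M a S → p ∈ S →
    𝒟.toCauchyDevelopment.HasCutBondiMass ({p} : Set 𝒟.carrier) m → m ≤ γ →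
    ∃ S' : Set 𝒟.carrier, 𝒟.toCauchyDevelopment.IsSoundNearKerrLeaf k ε 0 M a S' ∧
      S' ⊆ 𝒟.metric.causalFuture 𝒟.timeOrientation ({p} : Set 𝒟.carrier)

/-! ### Bookkeeping: what B1 does together with the gap clause (proved) -/

section Bookkeeping

variable {X : Type} [TopologicalSpace X] [ChartedSpace E3 X] [IsManifold (𝓡 3) ∞ X]
  [ConnectedSpace X] {D : InitialDataSet (𝓡 3) X}

/-- **Gap + cheap competitors ⇒ small own cut energy**: if the core `{p}` has competitor masses
`≤ η` for every `η > 0` and its Bondi–Bartnik gap is `≤ γ`, then for every `η > 0` its own cone cut has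
an energy `≤ γ + η` (`bondiBartnikGapLE_iff` with `η/2` twice). -/
theorem exists_hasCutBondiMass_le_of_gap (𝒟 : VacuumCauchyDevelopment D) {p : 𝒟.carrier} {γ : ℝ}
    (hcheap : ∀ η : ℝ, 0 < η → ∃ m' : ℝ, 𝒟.IsCompetitorMass ({p} : Set 𝒟.carrier) m' ∧ m' ≤ η)
    (hgap : 𝒟.BondiBartnikGapLE ({p} : Set 𝒟.carrier) γ) {η : ℝ} (hη : 0 < η) :
    ∃ m : ℝ, 𝒟.toCauchyDevelopment.HasCutBondiMass ({p} : Set 𝒟.carrier) m ∧ m ≤ γ + η := by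
  obtain ⟨m', hm', hm'le⟩ := hcheap (η / 2) (by positivity)
  obtain ⟨m, hm, hmle⟩ :=
    (VacuumCauchyDevelopment.bondiBartnikGapLE_iff.1 hgap) m' hm' (η / 2) (by positivity)
  exact ⟨m, hm, by linarith⟩

/-- **The self-competitor is idle**: the gap clause applied to the identity competitor
(`isCompetitor_id`) and an own cut energy `m₀` returns an own cut energy `≤ m₀ + γ + η`, which `m₀`
itself witnesses whenever `0 ≤ γ` — no information; this is why B1 is needed. -/
theorem gap_self_idle (𝒟 : VacuumCauchyDevelopment D) {p : 𝒟.carrier} {γ m₀ : ℝ} (hγ : 0 ≤ γ)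
    (hm₀ : 𝒟.toCauchyDevelopment.HasCutBondiMass ({p} : Set 𝒟.carrier) m₀) {η : ℝ} (hη : 0 < η) :
    ∃ m : ℝ, 𝒟.toCauchyDevelopment.HasCutBondiMass ({p} : Set 𝒟.carrier) m ∧ m ≤ m₀ + γ + η :=
  ⟨m₀, hm₀, by linarith⟩

/-- **B1 at work**: under `ProbeBartnikMassZero`, a point of `J⁺(ι X)` of an MGHD of admissible data whose
Bondi–Bartnik gap is `≤ γ` has, for every `η > 0`, an own cut energy `≤ γ + η`. -/
theorem exists_hasCutBondiMass_le_of_probeBartnikMassZero (hB1 : ProbeBartnikMassZero)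
    [T2Space X] [SecondCountableTopology X] (hD : D ∈ admissibleVacuumData X)
    (𝒟 : VacuumCauchyDevelopment D) {p : 𝒟.carrier} {γ : ℝ} (hmax : 𝒟.IsMaximal)
    (hp : p ∈ 𝒟.metric.causalFuture 𝒟.timeOrientation (range 𝒟.embed))
    (hgap : 𝒟.BondiBartnikGapLE ({p} : Set 𝒟.carrier) γ) {η : ℝ} (hη : 0 < η) :
    ∃ m : ℝ, 𝒟.toCauchyDevelopment.HasCutBondiMass ({p} : Set 𝒟.carrier) m ∧ m ≤ γ + η :=
  exists_hasCutBondiMass_le_of_gap 𝒟 (hB1 X D hD 𝒟 p hmax hp) hgap hη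

end Bookkeeping

end ProbeRoute

/-- **Registered brick of the line** (`stub_probeBartnikMassZeroGap`, for `stub_probeSector`): the
B1-half of the probe-sector reduction in closed form — `ProbeBartnikMassZero` turns the gap clause of a
point into a bound on the point's own cut energy. [conjecture] [folklore] -/
theorem stub_probeBartnikMassZeroGap : ProbeRoute.ProbeBartnikMassZero →
    ∀ (X : Type) [TopologicalSpace X] [ChartedSpace E3 X] [IsManifold (𝓡 3) ∞ X]
      [T2Space X] [SecondCountableTopology X] [ConnectedSpace X],
    ∀ D ∈ admissibleVacuumData X, ∀ (𝒟 : VacuumCauchyDevelopment D) (p : 𝒟.carrier) (γ : ℝ),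
    𝒟.IsMaximal → p ∈ 𝒟.metric.causalFuture 𝒟.timeOrientation (range 𝒟.embed) →
    𝒟.BondiBartnikGapLE ({p} : Set 𝒟.carrier) γ →
    ∀ η : ℝ, 0 < η → ∃ m : ℝ, 𝒟.toCauchyDevelopment.HasCutBondiMass ({p} : Set 𝒟.carrier) m ∧
      m ≤ γ + η :=
  fun hB1 _ _ _ _ _ _ _ _ hD 𝒟 _ _ hmax hp hgap _ hη ↦
    ProbeRoute.exists_hasCutBondiMass_le_of_probeBartnikMassZero hB1 hD 𝒟 hmax hp hgap hη

end Summit.FinalStateConjecture.FinalStateConjecture.Theorems.BondiBartnikRigidity.DirectMethod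

end
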